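import Summits.ResolutionOfSingularities.ResolutionOfSingularities.Theorems.HomologicalConductorNoZenoBirthDefs
import Summits.ResolutionOfSingularities.ResolutionOfSingularities.Theorems.HomologicalConductorNoZenoTowerNoetherian
import Summits.ResolutionOfSingularities.ResolutionOfSingularities.Theorems.HomologicalConductorNoZenoIffKernel
import Summits.ResolutionOfSingularities.ResolutionOfSingularities.Theorems.HomologicalConductorNoZenoDim2RegularCentre
import Summits.ResolutionOfSingularities.ResolutionOfSingularities.Theorems.HomologicalConductorStrictDropTowerShape
import Summits.ResolutionOfSingularities.ResolutionOfSingularities.Theorems.HomologicalConductorStrictDropDimLEOne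
import Summits.ResolutionOfSingularities.ResolutionOfSingularities.Theorems.SyzygyFlatteningHigherRankTerminationLocAt
import Literature.AlgebraicGeometry.Resolution.LocalUniformization
import HarnessLib

/-!
# Route `HomologicalConductor`, support `SurfaceTermination` (stmt-ResolutionOfSingularities-16488): settled regimes

`SurfaceTermination` asks, UNCONDITIONALLY (no `Persistence`, no `StrictDrop`), that for a
finitely generated `A ⊆ O ⊆ K = Frac A` of Krull dimension `2` (`k ⊆ O` a valuation ring of `K`,
`char k = p`) the canonical normalised `ca`-tower `T₀ = loc O A`, `T_(m+1) = loc O (nrm (chart O T_m))`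
(`Theorems/HomologicalConductorNoZenoBirthDefs.lean`) reaches a regular local ring. This file
records the regimes that are settled by the landed lemmas of the route, so that the kill test
K4.4 (cell `res-hironaka`, ladder L, slot W4.4) is aimed at the genuine content only:

* **R0 (centre of height ≤ 1).** If `dim T₀ ≤ 1` — equivalently (`dim A = 2`, `A` a catenary
  affine domain is not needed: only `height 𝔭 + 1 ≤ height 𝔪 ≤ dim A`) if the centre
  `𝔭 = 𝔪_O ∩ A` of `O` on `A` is not a maximal ideal, e.g. `O = K` or `O` the discrete valuation
  ring of a prime divisor centred on a curve of `Spec A` — then `T₀` or `T₁` is regular: the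
  CurveStep mechanism (`StrictDrop.Birth.DimLEOne.stub_dimLEOne_succ_regular`, Krull–Akizuki).
  (`exists_regular_of_ringKrullDim_tower_zero_le_one`, `ringKrullDim_tower_zero_eq_height`,
  `exists_regular_of_centre_not_isMaximal`.)
* **R2 (capture).** If `O` is essentially of finite type over `k` — `O = loc O B` for a finitely
  generated `B ⊆ O`, as for `O = K`, a divisorial DVR, … — and the stages exhaust `B`, then some
  stage EQUALS `O`; if moreover `O` is regular (a DVR or `K`) the tower terminates.
  (`exists_tower_eq_of_exhausts`, `exists_regular_of_exhausts`.)

What is NOT settled here (the content of K4.4): `O` centred at a closed point with `T_m`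
singular and two-dimensional for all `m` — exhaustion `⋃ T_m = O` along divisorial `O`, and the
zero-dimensional valuations (rank one non-discrete, rank two), see `Cruxes/NoZeno/KERNEL-c1.md` §3
and `L/w44/CHAIN.md` §3.2.

References: H. Matsumura, *Commutative Ring Theory*, Thm. 11.7 (Krull–Akizuki) and §5
(dimension of localisations) [`Matsumura1987`]; O. Zariski, P. Samuel, *Commutative Algebra* II,
VI §5 [`ZariskiSamuel1960`].
-/

noncomputable section

-- single-problem summit: the doubled namespace component `ResolutionOfSingularities` is forced
set_option linter.dupNamespace false

namespace Summit.ResolutionOfSingularities.ResolutionOfSingularities.Theorems.SurfaceTermination.Regimes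

open Summit.ResolutionOfSingularities.ResolutionOfSingularities.Theses.HomologicalConductor
open Summit.ResolutionOfSingularities.ResolutionOfSingularities.Theorems.NoZeno.Birth
open Literature.AlgebraicGeometry.Resolution IsLocalRing

variable {k K : Type} [Field k] [Field K] [Algebra k K]

/-! ## R0 — centre of height at most one -/

/-- **R0.** If the first stage `T₀ = loc O A` has Krull dimension `≤ 1`, the tower reaches a
regular local ring at `m ≤ 1`: either `T₀` is regular, or it is a singular noetherian local
domain of dimension `≤ 1` and the next stage — a normal noetherian local domain of dimension
`≤ 1` (Krull–Akizuki) — is regular (`StrictDrop.Birth.DimLEOne.stub_dimLEOne_succ_regular`, fed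
by the tower-shape invariant `StrictDrop.Birth.TowerShape.stub_towerShape`). Unconditional: no
`Persistence`/`StrictDrop`. [cite: Matsumura1987, Thm. 11.7] -/
theorem exists_regular_of_ringKrullDim_tower_zero_le_one (p : ℕ) (hp : p.Prime) (k K : Type)
    [Field k] [CharP k p] [Field K] [Algebra k K] (O : ValuationSubring K) (A : Subalgebra k K)
    (hk : ∀ c : k, algebraMap k K c ∈ O) (hA : A.FG) (hfr : IsFractionRing ↥A K)
    (hAO : A.toSubring ≤ O.toSubring) (hdim : ringKrullDim ↥(tower O A 0) ≤ 1) :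
    ∃ m : ℕ, IsRegularLocalRing ↥(tower O A m) := by
  -- adapted from `Theorems/HomologicalConductorCurveStep.lean`
  have hshape := StrictDrop.Birth.TowerShape.stub_towerShape p hp k K O A hk hA hfr hAO
  by_cases hreg : IsRegularLocalRing ↥(tower O A 0)
  · exact ⟨0, hreg⟩
  · exact ⟨1, StrictDrop.Birth.DimLEOne.stub_dimLEOne_succ_regular p hp k K O A hk hA hfr hAO
      hshape 0 hdim hreg⟩

/-- **The dimension of `T₀` is the height of the centre** `𝔭 = 𝔪_O ∩ A` of `O` on `A`:
`T₀ = loc O A` is (inside `K`) the localisation `A_𝔭`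
(`SyzygyFlattening.locAt_toSubring_eq_centreLocalization`), and `dim A_𝔭 = height 𝔭`.
[cite: Matsumura1987, §5] -/
theorem ringKrullDim_tower_zero_eq_height (O : ValuationSubring K) (A : Subalgebra k K)
    (hfr : IsFractionRing ↥A K) (hAO : A.toSubring ≤ O.toSubring) :
    ringKrullDim ↥(tower O A 0) = (centreIdeal A O hAO).height := by
  haveI : IsFractionRing ↥A.toSubring K := hfr
  have hT : (tower O A 0).toSubring = (Localization.subalgebra.ofField K
      (centreIdeal A O hAO).primeCompl (Ideal.primeCompl_le_nonZeroDivisors _)).toSubring := by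
    rw [tower_zero, loc_eq_locAt]
    exact SyzygyFlattening.locAt_toSubring_eq_centreLocalization O A hAO
  let e : ↥(tower O A 0) ≃+* ↥(Localization.subalgebra.ofField K
      (centreIdeal A O hAO).primeCompl (Ideal.primeCompl_le_nonZeroDivisors _)) :=
    RingEquiv.subringCongr hT
  rw [ringKrullDim_eq_of_ringEquiv e]
  exact IsLocalization.AtPrime.ringKrullDim_eq_height (centreIdeal A O hAO)
    ↥(Localization.subalgebra.ofField K (centreIdeal A O hAO).primeCompl
      (Ideal.primeCompl_le_nonZeroDivisors _))

/-- If `dim A = 2` and the centre `𝔭` of `O` on `A` is not a maximal ideal, then `dim T₀ ≤ 1`: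
`𝔭 < 𝔪` for a maximal `𝔪`, so `height 𝔭 + 1 ≤ height 𝔪 ≤ dim A = 2`. [cite: Matsumura1987, §5] -/
theorem ringKrullDim_tower_zero_le_one_of_not_isMaximal (O : ValuationSubring K)
    (A : Subalgebra k K) (hfr : IsFractionRing ↥A K) (hAO : A.toSubring ≤ O.toSubring)
    (hdimA : ringKrullDim ↥A = 2) (hcen : ¬ (centreIdeal A O hAO).IsMaximal) :
    ringKrullDim ↥(tower O A 0) ≤ 1 := by
  set 𝔭 := centreIdeal A O hAO with h𝔭def
  obtain ⟨𝔪, h𝔪, h𝔭𝔪⟩ := Ideal.exists_le_maximal 𝔭 (Ideal.IsPrime.ne_top inferInstance)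
  have hlt : 𝔭 < 𝔪 := lt_of_le_of_ne h𝔭𝔪 fun h => hcen (h ▸ h𝔪)
  haveI := h𝔪.isPrime
  have h𝔪2 : 𝔪.height ≤ 2 := by
    have h : ((𝔪.height : ℕ∞) : WithBot ℕ∞) ≤ ((2 : ℕ∞) : WithBot ℕ∞) := by
      have h' := Ideal.height_le_ringKrullDim_of_isPrime (I := 𝔪)
      rw [hdimA] at h'
      exact h'
    exact WithBot.coe_le_coe.mp h
  have h𝔭1 : 𝔭.height ≤ 1 := by
    have h := (Ideal.height_add_one_le_of_lt_of_isPrime hlt).trans h𝔪2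
    by_cases htop : 𝔭.height = ⊤
    · rw [htop, top_add] at h
      exact absurd h (by decide)
    · obtain ⟨n, hn⟩ := ENat.ne_top_iff_exists.mp htop
      rw [← hn] at h ⊢
      have h2 : n + 1 ≤ 2 := by exact_mod_cast h
      exact_mod_cast (by omega : n ≤ 1)
  rw [ringKrullDim_tower_zero_eq_height O A hfr hAO]
  exact_mod_cast h𝔭1

/-- **R0, geometric form.** For `A` of Krull dimension `2`, if the centre of `O` on `A` is not a
closed point (`O = K`, or `O` centred on a curve of `Spec A` — e.g. the DVR of a prime divisor
whose centre is a curve), the tower reaches a regular local ring at `m ≤ 1`.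
[cite: Matsumura1987, Thm. 11.7] -/
theorem exists_regular_of_centre_not_isMaximal (p : ℕ) (hp : p.Prime) (k K : Type)
    [Field k] [CharP k p] [Field K] [Algebra k K] (O : ValuationSubring K) (A : Subalgebra k K)
    (hk : ∀ c : k, algebraMap k K c ∈ O) (hA : A.FG) (hfr : IsFractionRing ↥A K)
    (hAO : A.toSubring ≤ O.toSubring) (hdimA : ringKrullDim ↥A = 2)
    (hcen : ¬ (centreIdeal A O hAO).IsMaximal) :
    ∃ m : ℕ, IsRegularLocalRing ↥(tower O A m) :=
  exists_regular_of_ringKrullDim_tower_zero_le_one p hp k K O A hk hA hfr hAO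
    (ringKrullDim_tower_zero_le_one_of_not_isMaximal O A hfr hAO hdimA hcen)

/-! ## R2 — capture of an essentially-of-finite-type valuation ring -/

/-- Every stage is its own localisation at the centre: `loc O T_m = T_m`. [folklore] -/
theorem loc_tower (O : ValuationSubring K) (A : Subalgebra k K)
    (hk : ∀ c : k, algebraMap k K c ∈ O) (hAO : A.toSubring ≤ O.toSubring) (m : ℕ) :
    loc O (tower O A m) = tower O A m := by
  obtain ⟨C, hCO, hTC⟩ := exists_tower_eq_loc O A hk hAO m
  rw [hTC, loc_eq_locAt]
  exact SyzygyFlattening.locAt_locAt O C hCO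

/-- **R2 (capture).** If `O ⊆ loc O B` for a finitely generated `B ⊆ O` (i.e. `O` is essentially
of finite type over `k`: `O = K`, a divisorial DVR, …) and every element of `B` lies in some
stage, then some stage EQUALS `O`: the finitely many generators of `B` lie in one `T_m`, so
`B ≤ T_m` and `O ≤ loc O B ≤ loc O T_m = T_m ≤ O`. [cite: ZariskiSamuel1960, VI §5] -/
theorem exists_tower_eq_of_exhausts (O : ValuationSubring K) (A : Subalgebra k K)
    (hk : ∀ c : k, algebraMap k K c ∈ O) (hAO : A.toSubring ≤ O.toSubring)
    (B : Subalgebra k K) (hB : B.FG) (hOB : O.toSubring ≤ (loc O B).toSubring)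
    (hexh : ∀ x ∈ B, ∃ m : ℕ, x ∈ tower O A m) :
    ∃ m : ℕ, (tower O A m).toSubring = O.toSubring := by
  classical
  obtain ⟨F, hF⟩ := hB
  have hFB : ∀ f ∈ F, f ∈ B := fun f hf => hF ▸ Algebra.subset_adjoin hf
  choose! g hg using fun f (hf : f ∈ F) => hexh f (hFB f hf)
  refine ⟨F.sup g, le_antisymm
    (fun x hx => mem_valuationSubring_of_mem_tower O hk hAO _ x hx) ?_⟩
  have hBT : B ≤ tower O A (F.sup g) := by
    rw [← hF]
    refine Algebra.adjoin_le fun f hf => ?_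
    exact d2rc_mem_tower_of_le O A (Finset.le_sup hf) (hg f hf)
  intro x hx
  have hx' : x ∈ loc O B := hOB hx
  have h : loc O B ≤ loc O (tower O A (F.sup g)) := by
    rw [loc_eq_locAt, loc_eq_locAt]
    exact SyzygyFlattening.locAt_mono O hBT
  have hx'' := h hx'
  rw [loc_tower O A hk hAO] at hx''
  exact hx''

/-- A stage equal to `O` (as a subring of `K`) is regular as soon as `O` is. [folklore] -/
theorem isRegularLocalRing_tower_of_toSubring_eq (O : ValuationSubring K) (A : Subalgebra k K)
    (m : ℕ) (h : (tower O A m).toSubring = O.toSubring) (hO : IsRegularLocalRing ↥O) :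
    IsRegularLocalRing ↥(tower O A m) :=
  IsRegularLocalRing.of_ringEquiv (RingEquiv.subringCongr h).symm

/-- A discrete valuation ring is a regular local ring (a local principal ideal domain).
[cite: Matsumura1987, Thm. 11.2] -/
theorem isRegularLocalRing_of_isDiscreteValuationRing (O : ValuationSubring K)
    [hdvr : IsDiscreteValuationRing ↥O] : IsRegularLocalRing ↥O := by
  haveI : IsPrincipalIdealRing ↥O := hdvr.toIsPrincipalIdealRing
  infer_instance

/-- **R2 (termination by capture).** If `O` is a discrete valuation ring essentially of finite
type over `k` (`O ⊆ loc O B`, `B ⊆ O` finitely generated — e.g. a divisorial valuation) and the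
stages exhaust `B`, the tower terminates: some `T_m = O` is regular.
[cite: ZariskiSamuel1960, VI §5] -/
theorem exists_regular_of_exhausts (O : ValuationSubring K) (A : Subalgebra k K)
    (hk : ∀ c : k, algebraMap k K c ∈ O) (hAO : A.toSubring ≤ O.toSubring)
    [IsDiscreteValuationRing ↥O] (B : Subalgebra k K) (hB : B.FG)
    (hOB : O.toSubring ≤ (loc O B).toSubring) (hexh : ∀ x ∈ B, ∃ m : ℕ, x ∈ tower O A m) :
    ∃ m : ℕ, IsRegularLocalRing ↥(tower O A m) := by
  obtain ⟨m, hm⟩ := exists_tower_eq_of_exhausts O A hk hAO B hB hOB hexh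
  exact ⟨m, isRegularLocalRing_tower_of_toSubring_eq O A m hm
    (isRegularLocalRing_of_isDiscreteValuationRing O)⟩

end Summit.ResolutionOfSingularities.ResolutionOfSingularities.Theorems.SurfaceTermination.Regimes

end
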